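import Summits.QuantumFields.YangMills.Theorems.LuscherReductionTwistedTraceScalingBOStiffSepEventually
import Summits.QuantumFields.YangMills.Theorems.LuscherReductionTwistedTraceScalingBOStiffSepRecord
import Summits.QuantumFields.YangMills.Theorems.LuscherReductionTwistedTraceScalingBORecordSupport
import HarnessLib

/-!
# (C5-α, closed) THE STIFF-SEPARATION KERNEL BOUND `hsep` ON `S_out × V_in`, eventually in `β`, for every `s ∈ (1/6, 1/2)`
# (lane A of S-BASE, crux `TwistedTraceScaling` stmt-QuantumFields-20203, C4-CORE, the (OD) pen; `pub/ym-fleet/ym-luscher-20007-p1/HANDOFF-g20.md` (α))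

★★★ `hsep_record`: eventually in `β`, for `U ∈ orthoTubeSet ∩ {χ ≠ 0} ∩ {r_F/12 < ‖x̂'‖}` with `‖P_Γ x̂'‖ ≤ β^{-1}ℓ` and `V ∈ orthoTubeSet ∩ {‖x̂‖ ≤ r_F/24} ∩ {‖P_Γ x̂‖ ≤ β^{-1}ℓ} ∩ {slow window δ₁}`,
`avgKernel β U V ≤ e^{2β|E|}·e^{−β(r_F/1000)²}` — EXACTLY the hypothesis `hsep` of `…BODefectOutPiece.out_sq_integral_le_of_sep` at `R₀ = r_F/12`, `τ = β^{-1}ℓ`, `δ = recordDelta1`,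
`K_sep = e^{2β|E|}e^{−β(r_F/1000)²}` (`= e^{2β|E|}e^{−ℓ²/10⁶}` on schedule B, super-polynomially small).  Composition of `…BORecordSupport.recordChi_support` (links and slow window of
`U`), `…VacGradKernel.exists_poincare_vacGrad`, `…BOStiffSepEventually.eventually_stiffSep_conditions` and `…BOStiffSepRecord.avgKernel_le_of_stiffSep_record`.
This closes sub-stub (C5)(iii) (stiff separation) of the coarse cut for every `s ∈ (1/6, 1/2)`.
HONEST FRAMING: a stub of a child of the CONDITIONAL route R2b1; the hOD assembly (absolute currency floor + `hOD_of_defect`), (B-ST), C4-CORE remain OPEN; not a gap, not Clay.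
-/

set_option autoImplicit false

noncomputable section

open Filter Topology Real
open scoped BigOperators
open Literature.MathematicalPhysics.QuantumFieldTheory
open Literature.MathematicalPhysics.QuantumLattice

namespace Summit.QuantumFields.YangMills.Theorems.FemtoTransferGap.TwoLattice.ConstTube

open Summit.QuantumFields.YangMills.Theorems.FemtoTransferGap
open Summit.QuantumFields.YangMills.Theorems.FemtoTransferGap.TwoLattice
open Summit.QuantumFields.YangMills.Theorems.FemtoTransferGap.TwoLattice.Avg

variable {L : ℕ} [NeZero L]

set_option maxHeartbeats 800000 in
-- large record expressions.
/-- ★★★ **THE STIFF-SEPARATION KERNEL BOUND ON `S_out × V_in`, eventually** (see the module docstring). [cite: Luscher1983, §3] -/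
theorem hsep_record {s : ℝ} (hs6 : 1 / 6 < s) (hs2 : s < 1 / 2) {M : ℝ} (hM : 0 ≤ M) :
    ∀ᶠ β : ℝ in atTop,
      ∀ U ∈ orthoTubeSet L ∩ {U | (recordChi L s 43 M β) U ≠ 0} ∩ {U | (min (1 / 40) (powScale (1 / 2) β * btLog β)) / 12 < ‖relLinkVec L U‖},
        ‖(gaugeModes L).starProjection (relLinkVec L U)‖ ≤ (powScale 1 β * btLog β) →
        ∀ V ∈ orthoTubeSet L ∩ {V | ‖relLinkVec L V‖ ≤ (min (1 / 40) (powScale (1 / 2) β * btLog β)) / 12 / 2} ∩ {V | ‖(gaugeModes L).starProjection (relLinkVec L V)‖ ≤ (powScale 1 β * btLog β)} ∩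
          {V | ∀ k : Fin 3, ‖su2Quat (slowMean L V (0, k)) - 1‖ ≤ recordDelta1 L s β},
          avgKernel β U V ≤ Real.exp (2 * β) ^ Fintype.card (Edge 3 L) * Real.exp (-(β * ((min (1 / 40) (powScale (1 / 2) β * btLog β)) / 1000) ^ 2)) := by
  have hs : 0 < s := by linarith
  obtain ⟨C, hC, hP⟩ := exists_poincare_vacGrad (L := L)
  filter_upwards [recordChi_support (L := L) hs hM, eventually_stiffSep_conditions (L := L) hs6 hs2 hM hC, eventually_ge_atTop (0 : ℝ)] with β hsupp hcond hβ0 U hU hτU V hV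
  obtain ⟨hrF0, hrF, hτ0, hδ0, hδ1, hδ'0, haU0, hsmall, hϑ1, hg₁, hB⟩ := hcond
  simp only [Set.mem_inter_iff, Set.mem_setOf_eq] at hU hV
  obtain ⟨⟨hUo, hUχ⟩, hUfar⟩ := hU
  obtain ⟨⟨⟨hVo, hVin⟩, hVτ⟩, hVslow⟩ := hV
  obtain ⟨u', x', hx', rfl⟩ := hUo
  obtain ⟨u, x, hx, rfl⟩ := hVo
  rw [relLinkVec_orthoTube L u' hx'] at hUfar hτU
  rw [relLinkVec_orthoTube L u hx] at hVin hVτ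
  rw [slowMean_orthoTube L u hx] at hVslow
  obtain ⟨hlinks, -, -, hslow', -⟩ := hsupp _ hUχ
  rw [slowMean_orthoTube L u' hx'] at hslow'
  have e24 : (min (1 / 40) (powScale (1 / 2) β * btLog β)) / 12 / 2 = (min (1 / 40) (powScale (1 / 2) β * btLog β)) / 24 := by ring
  rw [e24] at hVin
  exact avgKernel_le_of_stiffSep_record hβ0 hC hP hrF0 hrF hτ0 hδ0 hδ1 hδ'0 haU0 hsmall hϑ1 hg₁ hB hx hx' hlinks hslow' hVslow hUfar hτU hVin hVτ

end Summit.QuantumFields.YangMills.Theorems.FemtoTransferGap.TwoLattice.ConstTube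

end
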